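import Summits.NavierStokesRegularity.OSWSelfSimilar.SheetRWeakToStrong
import HarnessLib

/-!
# SHEET-ℝ frame on the WHOLE energy class: sup bound, weighted isometry, velocity bound, weighted Cauchy–Schwarz, and the
# (C4) bilinear estimate — for `H¹`-type profiles, no `C¹` hypothesis and no density step

HONEST FRAMING (cell ns-blowup GROUP B / zone Z3, case Z3-SR-CERT; 1-D MODEL certificate frame (viscous gCLM/OSW on the line); not Euler/NS;
«violates: none — MODEL»). Nothing here asserts that a profile exists.

The certificate frame (`CertificateViscousSheetR.lean`; PRICE-impl1 §1–§2) works in `E = H¹_{w}`, `w = L² + ξ²`,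
`‖δ‖²_E = ∫ w(δ′² + ¼δ²)`, and uses (E4) «`‖Hδ‖_w = ‖δ‖_w` for odd `δ`, `sup|δ| ≤ √2‖δ‖_E/L`, `|𝒰δ| ≤ (π/(4L))^{1/2}‖δ‖_w`» and (C4) «the
quadratic part `Q u v = a·𝒰u·v′ − (Hu)·v` of `G` satisfies `|⟨Q u v, wφ⟩| ≤ M‖u‖_E‖v‖_E‖φ‖_E`, `M = 2[2√2/L + 2a(π/(4L))^{1/2}]`,
`L_lip = 2M`».  The tree had these on the `C¹` subclass (`SheetREnergySupBound`, `SheetRWeightedEmbeddings`, cert-2's isometries with a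
residual p.v. hypothesis).  Writing an element of `E` as a primitive `Ω = Ω(0) + ∫₀Ω₁` with `∫wΩ² < ∞`, `∫wΩ₁² < ∞` (the form of
`SheetRWeakToStrong`), this file proves them on the WHOLE class: `sq_le_energy_of_primitive` (Agmon's inequality through Mathlib's absolutely
continuous calculus: `Ω²` is AC, `(Ω²)′ = 2ΩΩ₁` a.e. by Lebesgue differentiation, `Ω(a)² → 0` along `a → −∞` because `Ω² ∈ L¹`),
`weightedIsometry_of_primitive` (cert-2's `integral_weight_mul_hilbertTransform_sq_eq_of_memLp` with its p.v. hypothesis discharged by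
`SheetRWeakProfilePV.integrableOn_symmIntegrand_of_primitive`), `abs_velocity_le_of_primitive`, `integral_weight_abs_mul_le` (weighted
Cauchy–Schwarz by AM–GM), and the trilinear bound `abs_pairing_quadratic_le` = PRICE (C4)'s `M`.  Pure calculus; no definition, no named fact.
WHAT THIS IS NOT: not NS; not the Hilbert-space packaging of `E` (the MODEL ASSEMBLY of `CertificateViscousSheetRChain` still quantifies over an
abstract `E`).
-/

noncomputable section

namespace Summit.NavierStokesRegularity.OSWSelfSimilar
namespace SheetREnergyClass

open _root_.MeasureTheory _root_.Set _root_.Filter _root_.Function Literature.Analysis.Fourier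
  SheetRWeakProfilePV SheetRWeakToStrong
open scoped Real Topology

/-! ### Weighted Cauchy–Schwarz (AM–GM, no Hölder machinery) -/

/-- If `X ≤ (tA + B/t)/2` for every `t > 0` (`A, B ≥ 0`), then `X ≤ √A·√B`. [folklore] -/
private theorem le_sqrt_mul_sqrt_of_forall {X A B : ℝ} (hA : 0 ≤ A) (hB : 0 ≤ B)
    (h : ∀ t : ℝ, 0 < t → X ≤ (t * A + B / t) / 2) : X ≤ Real.sqrt A * Real.sqrt B := by
  rcases hA.eq_or_lt with hA0 | hApos
  · -- A = 0: X ≤ B/(2t) for all t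
    rw [← hA0, Real.sqrt_zero, zero_mul]
    refine le_of_forall_pos_lt_add fun ε hε => ?_
    have ht : 0 < B / ε + 1 := by positivity
    have hX := h _ ht
    rw [← hA0, mul_zero, zero_add] at hX
    have : B / (B / ε + 1) / 2 < ε := by
      rw [div_div, div_lt_iff₀ (by positivity)]
      nlinarith [mul_pos hε ht, div_mul_cancel₀ B hε.ne']
    linarith
  rcases hB.eq_or_lt with hB0 | hBpos
  · rw [← hB0, Real.sqrt_zero, mul_zero]
    refine le_of_forall_pos_lt_add fun ε hε => ?_
    have ht : 0 < ε / A := div_pos hε hApos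
    have hX := h _ ht
    rw [← hB0, zero_div, add_zero, div_mul_cancel₀ ε hApos.ne'] at hX
    linarith
  · have hsA := Real.sqrt_pos.2 hApos
    have hsB := Real.sqrt_pos.2 hBpos
    have hX := h (Real.sqrt B / Real.sqrt A) (div_pos hsB hsA)
    have e1 : Real.sqrt B / Real.sqrt A * A = Real.sqrt A * Real.sqrt B := by
      rw [div_mul_eq_mul_div, div_eq_iff hsA.ne']
      nlinarith [Real.mul_self_sqrt hA]
    have e2 : B / (Real.sqrt B / Real.sqrt A) = Real.sqrt A * Real.sqrt B := by
      rw [div_div_eq_mul_div, div_eq_iff hsB.ne']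
      nlinarith [Real.mul_self_sqrt hB]
    rw [e1, e2] at hX
    linarith

/-- **Weighted Cauchy–Schwarz.** For a.e.-strongly measurable `f, g` with `∫(L²+y²)f² < ∞`, `∫(L²+y²)g² < ∞`:
`(L²+y²)|f·g| ∈ L¹` and `∫ (L²+y²)|f·g| ≤ (∫(L²+y²)f²)^{1/2}·(∫(L²+y²)g²)^{1/2}`. [folklore] -/
theorem integral_weight_abs_mul_le {L : ℝ} {f g : ℝ → ℝ} (hfm : AEStronglyMeasurable f volume) (hgm : AEStronglyMeasurable g volume)
    (hf : Integrable fun y => (L ^ 2 + y ^ 2) * f y ^ 2) (hg : Integrable fun y => (L ^ 2 + y ^ 2) * g y ^ 2) :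
    Integrable (fun y => (L ^ 2 + y ^ 2) * |f y * g y|) ∧
      ∫ y, (L ^ 2 + y ^ 2) * |f y * g y| ≤
        Real.sqrt (∫ y, (L ^ 2 + y ^ 2) * f y ^ 2) * Real.sqrt (∫ y, (L ^ 2 + y ^ 2) * g y ^ 2) := by
  have hwm : AEStronglyMeasurable (fun y : ℝ => L ^ 2 + y ^ 2) volume := by fun_prop
  have hm : AEStronglyMeasurable (fun y => (L ^ 2 + y ^ 2) * |f y * g y|) volume :=
    hwm.mul (continuous_abs.comp_aestronglyMeasurable (hfm.mul hgm))
  -- pointwise AM–GM with parameter: w|fg| ≤ (t·w f² + w g²/t)/2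
  have hpt : ∀ t : ℝ, 0 < t → ∀ y : ℝ, (L ^ 2 + y ^ 2) * |f y * g y| ≤
      (t * ((L ^ 2 + y ^ 2) * f y ^ 2) + (L ^ 2 + y ^ 2) * g y ^ 2 / t) / 2 := by
    intro t ht y
    have hw : 0 ≤ L ^ 2 + y ^ 2 := by positivity
    have key : 2 * |f y * g y| ≤ t * f y ^ 2 + g y ^ 2 / t := by
      have h1 : 0 ≤ (t * |f y| - |g y|) ^ 2 / t := by positivity
      have h2 : (t * |f y| - |g y|) ^ 2 / t = t * f y ^ 2 + g y ^ 2 / t - 2 * |f y * g y| := by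
        field_simp
        rw [abs_mul]
        nlinarith [sq_abs (f y), sq_abs (g y)]
      linarith
    calc (L ^ 2 + y ^ 2) * |f y * g y| = ((L ^ 2 + y ^ 2) * (2 * |f y * g y|)) / 2 := by ring
      _ ≤ ((L ^ 2 + y ^ 2) * (t * f y ^ 2 + g y ^ 2 / t)) / 2 := by gcongr
      _ = (t * ((L ^ 2 + y ^ 2) * f y ^ 2) + (L ^ 2 + y ^ 2) * g y ^ 2 / t) / 2 := by ring
  have hint : Integrable (fun y => (L ^ 2 + y ^ 2) * |f y * g y|) := by
    refine ((hf.add hg).div_const 2).mono' hm (Eventually.of_forall fun y => ?_)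
    rw [Real.norm_eq_abs, abs_of_nonneg (by positivity)]
    have := hpt 1 one_pos y
    simpa using this
  refine ⟨hint, le_sqrt_mul_sqrt_of_forall (integral_nonneg fun y => by positivity)
    (integral_nonneg fun y => by positivity) fun t ht => ?_⟩
  calc ∫ y, (L ^ 2 + y ^ 2) * |f y * g y|
      ≤ ∫ y, (t * ((L ^ 2 + y ^ 2) * f y ^ 2) + (L ^ 2 + y ^ 2) * g y ^ 2 / t) / 2 :=
        integral_mono hint (((hf.const_mul t).add (hg.div_const t)).div_const 2) (hpt t ht)
    _ = (t * (∫ y, (L ^ 2 + y ^ 2) * f y ^ 2) + (∫ y, (L ^ 2 + y ^ 2) * g y ^ 2) / t) / 2 := by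
        rw [MeasureTheory.integral_div, integral_add (hf.const_mul t) (hg.div_const t), integral_const_mul,
          MeasureTheory.integral_div]

/-! ### `H¹`-type profiles: measurability and `L²` bookkeeping -/

/-- For an `H¹`-type profile with weighted data: `Ω` is continuous, `Ω, Ω₁ ∈ L²`, `Ω ∈ L¹`, `y·Ω ∈ L²`. [folklore] -/
theorem basic_of_primitive {Ω Ω₁ : ℝ → ℝ} {L : ℝ} (hL : 0 < L) (hΩ : ∀ x, Ω x = Ω 0 + ∫ s in (0 : ℝ)..x, Ω₁ s)
    (hΩ₁m : AEStronglyMeasurable Ω₁ volume) (h0 : Integrable fun y => (L ^ 2 + y ^ 2) * Ω y ^ 2)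
    (h1 : Integrable fun y => (L ^ 2 + y ^ 2) * Ω₁ y ^ 2) :
    Continuous Ω ∧ MemLp Ω₁ 2 ∧ MemLp Ω 2 ∧ Integrable Ω ∧ MemLp (fun y => y * Ω y) 2 := by
  have hΩ₁2 : MemLp Ω₁ 2 := memLp_two_of_weighted_sq hL hΩ₁m h1
  have hc : Continuous Ω := continuous_of_primitive hΩ (intervalIntegrable_of_memLp_two hΩ₁2)
  have hΩ2 : MemLp Ω 2 := memLp_two_of_weighted_sq hL hc.aestronglyMeasurable h0
  have hΩi : Integrable Ω := SheetRWeightedEmbeddings.integrable_of_weighted_sq hL hc.aestronglyMeasurable h0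
  have hxΩ : MemLp (fun y => y * Ω y) 2 := by
    have hm : AEStronglyMeasurable (fun y => y * Ω y) volume := by fun_prop
    rw [memLp_two_iff_integrable_sq hm]
    refine h0.mono' (hm.pow 2) (Eventually.of_forall fun y => ?_)
    rw [Real.norm_eq_abs, abs_of_nonneg (sq_nonneg _)]
    nlinarith [sq_nonneg (Ω y), sq_nonneg L, mul_nonneg (sq_nonneg L) (sq_nonneg (Ω y))]
  exact ⟨hc, hΩ₁2, hΩ2, hΩi, hxΩ⟩

/-! ### (E4) sup bound on the whole class: `Ω(x)² ≤ (2/L²)‖Ω‖²_E` -/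

/-- A primitive `Ω = Ω(0) + ∫₀Ω₁` of a locally integrable `Ω₁` is absolutely continuous on every interval. [folklore] -/
theorem absolutelyContinuousOnInterval_of_primitive {Ω Ω₁ : ℝ → ℝ} (hΩ : ∀ x, Ω x = Ω 0 + ∫ s in (0 : ℝ)..x, Ω₁ s)
    (hii : ∀ a b, IntervalIntegrable Ω₁ volume a b) (a b : ℝ) : AbsolutelyContinuousOnInterval Ω a b := by
  have e : Ω = fun x => Ω a + ∫ v in a..x, Ω₁ v := by
    funext x
    have := sub_eq_integral_of_primitive hΩ hii a x
    linarith
  rw [e]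
  exact ((contDiff_const (c := Ω a)).contDiffOn (s := uIcc a b)).absolutelyContinuousOnInterval.add
    ((hii a b).absolutelyContinuousOnInterval_intervalIntegral left_mem_uIcc)

/-- **Agmon on the energy class**: `Ω(x)² ≤ 2∫|Ω·Ω₁|` for `Ω = Ω(0) + ∫₀Ω₁` with `Ω, Ω₁ ∈ L²`. [folklore] -/
theorem sq_le_two_integral_abs_mul_of_primitive {Ω Ω₁ : ℝ → ℝ} (hΩ : ∀ x, Ω x = Ω 0 + ∫ s in (0 : ℝ)..x, Ω₁ s)
    (hΩ₁ : MemLp Ω₁ 2) (hΩ2 : MemLp Ω 2) (x : ℝ) : Ω x ^ 2 ≤ 2 * ∫ y, |Ω y * Ω₁ y| := by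
  have hii : ∀ a b, IntervalIntegrable Ω₁ volume a b := intervalIntegrable_of_memLp_two hΩ₁
  have hc : Continuous Ω := continuous_of_primitive hΩ hii
  -- |Ω Ω₁| is integrable
  have hprod : Integrable fun y => |Ω y * Ω₁ y| := by
    refine ((hΩ2.integrable_sq.add hΩ₁.integrable_sq).div_const 2).mono'
      (continuous_abs.comp_aestronglyMeasurable (hc.aestronglyMeasurable.mul hΩ₁.1)) (Eventually.of_forall fun y => ?_)
    rw [Real.norm_eq_abs, abs_abs, abs_mul]
    simp only [Pi.add_apply]
    nlinarith [sq_nonneg (|Ω y| - |Ω₁ y|), sq_abs (Ω y), sq_abs (Ω₁ y)]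
  have hprod' : Integrable fun y => Ω y * Ω₁ y :=
    hprod.mono' (hc.aestronglyMeasurable.mul hΩ₁.1) (Eventually.of_forall fun y => by rw [Real.norm_eq_abs])
  -- `HasDerivAt Ω (Ω₁ y) y` for a.e. `y`
  have hder : ∀ᵐ y : ℝ, HasDerivAt Ω (Ω₁ y) y := by
    filter_upwards [_root_.LocallyIntegrable.ae_hasDerivAt_integral (hΩ₁.locallyIntegrable one_le_two)] with y hy
    have e : Ω = fun x => Ω 0 + ∫ s in (0 : ℝ)..x, Ω₁ s := funext hΩ
    rw [e]
    exact (hy 0).const_add _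
  -- FTC for Ω² on [a, x]:  Ω x² − Ω a² = ∫_a^x 2 Ω Ω₁ ≤ 2 ∫ |Ω Ω₁|
  have hwin : ∀ a, a ≤ x → Ω x ^ 2 ≤ Ω a ^ 2 + 2 * ∫ y, |Ω y * Ω₁ y| := by
    intro a hax
    have hac : AbsolutelyContinuousOnInterval Ω a x := absolutelyContinuousOnInterval_of_primitive hΩ hii a x
    have hac2 : AbsolutelyContinuousOnInterval (Ω ^ 2) a x := by
      rw [pow_two]; exact hac.mul hac
    have hftc := hac2.integral_deriv_eq_sub
    simp only [Pi.pow_apply] at hftc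
    have hae : ∀ᵐ y : ℝ, deriv (Ω ^ 2) y = 2 * (Ω y * Ω₁ y) := by
      filter_upwards [hder] with y hy
      rw [(hy.pow 2).deriv]
      norm_num
      ring
    have e : ∫ y in a..x, deriv (Ω ^ 2) y = ∫ y in a..x, 2 * (Ω y * Ω₁ y) :=
      intervalIntegral.integral_congr_ae (hae.mono fun y hy _ => hy)
    rw [e] at hftc
    have hle : ∫ y in a..x, 2 * (Ω y * Ω₁ y) ≤ 2 * ∫ y, |Ω y * Ω₁ y| := by
      rw [intervalIntegral.integral_const_mul, intervalIntegral.integral_of_le hax]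
      refine mul_le_mul_of_nonneg_left ?_ (by norm_num)
      calc ∫ y in Ioc a x, Ω y * Ω₁ y ≤ ∫ y in Ioc a x, |Ω y * Ω₁ y| :=
            integral_mono hprod'.integrableOn hprod.integrableOn fun y => le_abs_self _
        _ ≤ ∫ y, |Ω y * Ω₁ y| := setIntegral_le_integral hprod (Eventually.of_forall fun y => abs_nonneg _)
    linarith
  -- Ω(a)² is small for some a ≤ x (Ω² ∈ L¹ and (−∞, x] has infinite measure)
  refine le_of_forall_pos_lt_add fun ε hε => ?_
  by_contra hcon
  have hcon' := not_lt.1 hcon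
  have hbig : ∀ a, a ≤ x → ε ≤ Ω a ^ 2 := fun a ha => by linarith [hwin a ha]
  have hsub : Iic x ⊆ {y | ε ≤ ‖Ω y ^ 2‖} := fun a ha => by
    rw [mem_setOf_eq, Real.norm_eq_abs, abs_of_nonneg (sq_nonneg _)]; exact hbig a ha
  have hfin := hΩ2.integrable_sq.measure_norm_ge_lt_top hε
  have htop : volume (Iic x) = ⊤ := Real.volume_Iic
  exact absurd ((measure_mono hsub).trans_lt hfin) (by rw [htop]; exact lt_irrefl _)

/-- **(E4) sup bound on the whole energy class.** For `Ω = Ω(0) + ∫₀Ω₁` with `∫(L²+y²)Ω² < ∞`, `∫(L²+y²)Ω₁² < ∞` (`L > 0`):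
`Ω(x)² ≤ (2/L²)·∫(L²+y²)(Ω₁² + ¼Ω²)` at every `x` — the AC form of `SheetREnergySupBound.sq_le_energy` (no `C¹`). [folklore] -/
theorem sq_le_energy_of_primitive {Ω Ω₁ : ℝ → ℝ} {L : ℝ} (hL : 0 < L) (hΩ : ∀ x, Ω x = Ω 0 + ∫ s in (0 : ℝ)..x, Ω₁ s)
    (hΩ₁m : AEStronglyMeasurable Ω₁ volume) (h0 : Integrable fun y => (L ^ 2 + y ^ 2) * Ω y ^ 2)
    (h1 : Integrable fun y => (L ^ 2 + y ^ 2) * Ω₁ y ^ 2) (x : ℝ) :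
    Ω x ^ 2 ≤ 2 / L ^ 2 * ∫ y, (L ^ 2 + y ^ 2) * (Ω₁ y ^ 2 + 1 / 4 * Ω y ^ 2) := by
  obtain ⟨hc, hΩ₁2, hΩ2, -, -⟩ := basic_of_primitive hL hΩ hΩ₁m h0 h1
  have hL2 : 0 < L ^ 2 := by positivity
  have hA := sq_le_two_integral_abs_mul_of_primitive hΩ hΩ₁2 hΩ2 x
  have hE : Integrable fun y => (L ^ 2 + y ^ 2) * (Ω₁ y ^ 2 + 1 / 4 * Ω y ^ 2) := by
    have := h1.add (h0.div_const 4)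
    refine this.congr (Eventually.of_forall fun y => ?_)
    simp only [Pi.add_apply]
    ring
  have hpt : ∀ y, |Ω y * Ω₁ y| ≤ 1 / L ^ 2 * ((L ^ 2 + y ^ 2) * (Ω₁ y ^ 2 + 1 / 4 * Ω y ^ 2)) := by
    intro y
    have h1' : |Ω y * Ω₁ y| ≤ Ω₁ y ^ 2 + 1 / 4 * Ω y ^ 2 := by
      rw [abs_le]; constructor <;> nlinarith [sq_nonneg (Ω y / 2 + Ω₁ y), sq_nonneg (Ω y / 2 - Ω₁ y)]
    have h2' : Ω₁ y ^ 2 + 1 / 4 * Ω y ^ 2 ≤ 1 / L ^ 2 * ((L ^ 2 + y ^ 2) * (Ω₁ y ^ 2 + 1 / 4 * Ω y ^ 2)) := by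
      rw [← mul_assoc, show 1 / L ^ 2 * (L ^ 2 + y ^ 2) = 1 + y ^ 2 / L ^ 2 by field_simp]
      have : 0 ≤ y ^ 2 / L ^ 2 * (Ω₁ y ^ 2 + 1 / 4 * Ω y ^ 2) := by positivity
      nlinarith
    exact h1'.trans h2'
  have hprod : Integrable fun y => |Ω y * Ω₁ y| := by
    refine ((hΩ2.integrable_sq.add hΩ₁2.integrable_sq).div_const 2).mono'
      (continuous_abs.comp_aestronglyMeasurable (hc.aestronglyMeasurable.mul hΩ₁2.1)) (Eventually.of_forall fun y => ?_)
    rw [Real.norm_eq_abs, abs_abs, abs_mul]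
    simp only [Pi.add_apply]
    nlinarith [sq_nonneg (|Ω y| - |Ω₁ y|), sq_abs (Ω y), sq_abs (Ω₁ y)]
  calc Ω x ^ 2 ≤ 2 * ∫ y, |Ω y * Ω₁ y| := hA
    _ ≤ 2 * ∫ y, 1 / L ^ 2 * ((L ^ 2 + y ^ 2) * (Ω₁ y ^ 2 + 1 / 4 * Ω y ^ 2)) :=
        mul_le_mul_of_nonneg_left (integral_mono hprod (hE.const_mul _) hpt) (by norm_num)
    _ = 2 / L ^ 2 * ∫ y, (L ^ 2 + y ^ 2) * (Ω₁ y ^ 2 + 1 / 4 * Ω y ^ 2) := by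
        rw [integral_const_mul]; ring

/-- Square-root form: `|Ω(x)| ≤ (√2/L)·‖Ω‖_E` on the whole energy class. [folklore] -/
theorem abs_le_sqrt_two_div_mul_energy_of_primitive {Ω Ω₁ : ℝ → ℝ} {L : ℝ} (hL : 0 < L)
    (hΩ : ∀ x, Ω x = Ω 0 + ∫ s in (0 : ℝ)..x, Ω₁ s) (hΩ₁m : AEStronglyMeasurable Ω₁ volume)
    (h0 : Integrable fun y => (L ^ 2 + y ^ 2) * Ω y ^ 2) (h1 : Integrable fun y => (L ^ 2 + y ^ 2) * Ω₁ y ^ 2) (x : ℝ) :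
    |Ω x| ≤ Real.sqrt 2 / L * Real.sqrt (∫ y, (L ^ 2 + y ^ 2) * (Ω₁ y ^ 2 + 1 / 4 * Ω y ^ 2)) := by
  have h := sq_le_energy_of_primitive hL hΩ hΩ₁m h0 h1 x
  rw [← Real.sqrt_sq_eq_abs]
  calc Real.sqrt (Ω x ^ 2) ≤ Real.sqrt (2 / L ^ 2 * ∫ y, (L ^ 2 + y ^ 2) * (Ω₁ y ^ 2 + 1 / 4 * Ω y ^ 2)) :=
        Real.sqrt_le_sqrt h
    _ = Real.sqrt 2 / L * Real.sqrt (∫ y, (L ^ 2 + y ^ 2) * (Ω₁ y ^ 2 + 1 / 4 * Ω y ^ 2)) := by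
        rw [Real.sqrt_mul (by positivity), Real.sqrt_div (by norm_num : (0 : ℝ) ≤ 2), Real.sqrt_sq hL.le]

/-! ### (E4) weighted isometry and velocity bound on the whole (odd) class -/

/-- **Weighted isometry on the whole energy class, no residual hypothesis.** For an ODD `H¹`-type profile `Ω = Ω(0) + ∫₀Ω₁` with
`∫(L²+y²)Ω² < ∞`, `∫(L²+y²)Ω₁² < ∞` (`L > 0`) and every real `c`: `x·HΩ ∈ L²` and `∫(c + x²)(HΩ)² = ∫(c + x²)Ω²`
(cert-2's `integral_weight_mul_hilbertTransform_sq_eq_of_memLp`, p.v. hypothesis discharged by `integrableOn_symmIntegrand_of_primitive`). [folklore] -/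
theorem weightedIsometry_of_primitive {Ω Ω₁ : ℝ → ℝ} {L : ℝ} (hL : 0 < L) (hΩ : ∀ x, Ω x = Ω 0 + ∫ s in (0 : ℝ)..x, Ω₁ s)
    (hodd : ∀ y, Ω (-y) = -Ω y) (hΩ₁m : AEStronglyMeasurable Ω₁ volume) (h0 : Integrable fun y => (L ^ 2 + y ^ 2) * Ω y ^ 2)
    (h1 : Integrable fun y => (L ^ 2 + y ^ 2) * Ω₁ y ^ 2) (c : ℝ) :
    MemLp (fun x => x * hilbertTransform Ω x) 2 ∧
      ∫ x, (c + x ^ 2) * (hilbertTransform Ω x) ^ 2 = ∫ x, (c + x ^ 2) * (Ω x) ^ 2 := by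
  obtain ⟨-, hΩ₁2, hΩ2, hΩi, hxΩ⟩ := basic_of_primitive hL hΩ hΩ₁m h0 h1
  exact integral_weight_mul_hilbertTransform_sq_eq_of_memLp hΩi hodd hΩ2 hxΩ
    (integrableOn_symmIntegrand_of_primitive hΩ hΩ₁2 hΩi) c

/-- The frame's form: `(L²+y²)(HΩ)² ∈ L¹` and `∫(L²+y²)(HΩ)² = ∫(L²+y²)Ω²` («`‖HΩ‖_w = ‖Ω‖_w`») on the whole odd energy class;
also `HΩ` is a.e.-strongly measurable and even. [folklore] -/
theorem weightedSq_hilbertTransform_of_primitive {Ω Ω₁ : ℝ → ℝ} {L : ℝ} (hL : 0 < L) (hΩ : ∀ x, Ω x = Ω 0 + ∫ s in (0 : ℝ)..x, Ω₁ s)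
    (hodd : ∀ y, Ω (-y) = -Ω y) (hΩ₁m : AEStronglyMeasurable Ω₁ volume) (h0 : Integrable fun y => (L ^ 2 + y ^ 2) * Ω y ^ 2)
    (h1 : Integrable fun y => (L ^ 2 + y ^ 2) * Ω₁ y ^ 2) :
    AEStronglyMeasurable (hilbertTransform Ω) volume ∧ (∀ y, hilbertTransform Ω (-y) = hilbertTransform Ω y) ∧
      Integrable (fun y => (L ^ 2 + y ^ 2) * hilbertTransform Ω y ^ 2) ∧
      ∫ y, (L ^ 2 + y ^ 2) * hilbertTransform Ω y ^ 2 = ∫ y, (L ^ 2 + y ^ 2) * Ω y ^ 2 := by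
  obtain ⟨-, hΩ₁2, hΩ2, hΩi, -⟩ := basic_of_primitive hL hΩ hΩ₁m h0 h1
  obtain ⟨hxH, hiso⟩ := weightedIsometry_of_primitive hL hΩ hodd hΩ₁m h0 h1 (L ^ 2)
  have hH2 : MemLp (hilbertTransform Ω) 2 := (memLp_two_hilbertTransform_of_primitive hΩ hΩ₁2 hΩi hΩ2).1
  have hint : Integrable (fun y => (L ^ 2 + y ^ 2) * hilbertTransform Ω y ^ 2) := by
    have := (hH2.integrable_sq.const_mul (L ^ 2)).add hxH.integrable_sq
    refine this.congr (Eventually.of_forall fun y => ?_)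
    simp only [Pi.add_apply]
    ring
  exact ⟨hH2.1, fun y => hilbertTransform_neg_arg_of_odd hodd y, hint, hiso⟩

/-- **Velocity bound on the whole odd energy class**: `|𝒰Ω(ξ)| = |∫₀^ξ HΩ| ≤ (π/(4L))^{1/2}·‖Ω‖_w` at every `ξ`
(`SheetRWeightedEmbeddings.abs_setIntegral_le_of_weighted_sq_even` for the even function `HΩ`, then `‖HΩ‖_w = ‖Ω‖_w`). [folklore] -/
theorem abs_velocity_le_of_primitive {Ω Ω₁ : ℝ → ℝ} {L : ℝ} (hL : 0 < L) (hΩ : ∀ x, Ω x = Ω 0 + ∫ s in (0 : ℝ)..x, Ω₁ s)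
    (hodd : ∀ y, Ω (-y) = -Ω y) (hΩ₁m : AEStronglyMeasurable Ω₁ volume) (h0 : Integrable fun y => (L ^ 2 + y ^ 2) * Ω y ^ 2)
    (h1 : Integrable fun y => (L ^ 2 + y ^ 2) * Ω₁ y ^ 2) (ξ : ℝ) :
    |∫ s in (0 : ℝ)..ξ, hilbertTransform Ω s| ≤ Real.sqrt (π / (4 * L)) * Real.sqrt (∫ y, (L ^ 2 + y ^ 2) * Ω y ^ 2) := by
  obtain ⟨hHm, heven, hwH, hiso⟩ := weightedSq_hilbertTransform_of_primitive hL hΩ hodd hΩ₁m h0 h1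
  rw [← hiso]
  -- reduce to `ξ ≥ 0` by evenness of `HΩ`
  have key : ∀ η : ℝ, 0 ≤ η → |∫ s in (0 : ℝ)..η, hilbertTransform Ω s| ≤
      Real.sqrt (π / (4 * L)) * Real.sqrt (∫ y, (L ^ 2 + y ^ 2) * hilbertTransform Ω y ^ 2) := by
    intro η hη
    rw [intervalIntegral.integral_of_le hη]
    exact SheetRWeightedEmbeddings.abs_setIntegral_le_of_weighted_sq_even hL hHm hwH heven Ioc_subset_Ioi_self
  rcases le_or_gt 0 ξ with hξ | hξ
  · exact key ξ hξ
  · have e : ∫ s in (0 : ℝ)..ξ, hilbertTransform Ω s = -∫ s in (0 : ℝ)..(-ξ), hilbertTransform Ω s := by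
      rw [intervalIntegral.integral_symm ξ 0]
      congr 1
      have h1 : ∫ s in ξ..0, hilbertTransform Ω s = ∫ s in ξ..0, hilbertTransform Ω (-s) :=
        intervalIntegral.integral_congr fun s _ => (heven s).symm
      rw [h1, intervalIntegral.integral_comp_neg, neg_zero]
    rw [e, abs_neg]
    exact key (-ξ) (by linarith)

end SheetREnergyClass
end Summit.NavierStokesRegularity.OSWSelfSimilar

end
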